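import Literature.NumberTheory.Weil1964.AdelicMetaplecticScalarTwist
import HarnessLib

/-!
# Scalar twists of sections into `Mp_ψ(W_𝔸)ᶜᵒⁿᵗ` form a `(H →* ℂˣ)`-action: `(s ⊗ η) ⊗ η' = s ⊗ (η'·η)`, `s ⊗ 1 = s`

Topic `NumberTheory/Weil1964`; namespace `Literature.NumberTheory.Weil1964` (sequel of `AdelicMetaplecticScalarTwist`).  KERNEL ONLY:
proved theorems, 0 definitions, 0 records, 0 `sorry`.

[MoeglinVignerasWaldspurger1987, Chap. 2 II.1 (B)]: the kernel of `Mp_ψ(W) → Sp(W)` is the central torus of scalars, so the set of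
homomorphic lifts `H → Mp_ψ(W_𝔸)` of a fixed `H → Sp(W_𝔸)` is a torsor under the character group `Hom(H, ℂˣ)` acting by the twist
`s ⊗ η : h ↦ (1, η(h)·id)·s(h)` (the tree's `adelicMpCont.twist`, ★ `adelicMpCont.exists_eq_twist`).  This file records the ACTION
axioms, which the tree lacked (a consumer holding `s' = s ⊗ ĉ` — e.g. ★ `GelbartRogawski1991.UnitaryDualPair.exists_eq_twist_of_isCompatible`,
[GelbartRogawski1991, §3.1 Remark p. 457 L4–13] — needs `s = s' ⊗ ĉ⁻¹` to feed a statement written the other way round):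

* `adelicMpCont.twist_one` — `s ⊗ 1 = s`;
* `adelicMpCont.twist_twist` — `(s ⊗ η) ⊗ η' = s ⊗ (η' · η)`;
* `adelicMpCont.twist_twist_inv`, `adelicMpCont.twist_inv_twist` — `(s ⊗ η) ⊗ η⁻¹ = s = (s ⊗ η⁻¹) ⊗ η`;
* `adelicMpCont.eq_twist_inv_of_eq_twist` — `s' = s ⊗ η → s = s' ⊗ η⁻¹`; `adelicMpCont.eq_twist_iff_eq_twist_inv` — the equivalence.

As in `AdelicMetaplecticScalarTwist` §2, identities between ELEMENTS of `Mp_ψ(W_𝔸)ᶜᵒⁿᵗ` are proved in term mode (the `rw` tactic is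
slow on products in this iterated subgroup); identities between HOMOMORPHISMS are then plain rewriting.

## References
* [MoeglinVignerasWaldspurger1987] C. Mœglin, M.-F. Vignéras, J.-L. Waldspurger, *Correspondances de Howe sur un corps p-adique*,
  LNM 1291 (1987), Chap. 2 II.1 (B).
* [GelbartRogawski1991] S. Gelbart, J. Rogawski, Invent. Math. 105 (1991), §3.1 Remark p. 457 L4–13.
-/

set_option autoImplicit false

noncomputable section

open NumberField IsDedekindDomain

namespace Literature.NumberTheory.Weil1964

open Literature.NumberTheory.Automorphic

variable {F : Type} [Field F] [NumberField F] {ι : Type} [Fintype ι] [DecidableEq ι]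
variable {T : Matrix ι ι (AdeleRing (𝓞 F) F)} {H : Type*} [Group H]
variable (s : H →* adelicMpCont F ι T) (η η' : H →* ℂˣ)

/-- `η⁻¹ · η = 1` for `ℂˣ`-valued characters (pointwise; stated here because the generic `inv_mul_cancel` does not unify with
`MonoidHom.mul`/`MonoidHom.instInv` by keyed matching). [folklore] -/
private theorem hom_inv_mul_cancel (η : H →* ℂˣ) : η⁻¹ * η = 1 :=
  MonoidHom.ext fun h => by rw [MonoidHom.mul_apply, MonoidHom.inv_apply, inv_mul_cancel, MonoidHom.one_apply]

/-- `η · η⁻¹ = 1`, pointwise. [folklore] -/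
private theorem hom_mul_inv_cancel (η : H →* ℂˣ) : η * η⁻¹ = 1 :=
  MonoidHom.ext fun h => by rw [MonoidHom.mul_apply, MonoidHom.inv_apply, mul_inv_cancel, MonoidHom.one_apply]

/-- `η' · η = η · η'`, pointwise. [folklore] -/
private theorem hom_mul_comm (η η' : H →* ℂˣ) : η' * η = η * η' :=
  MonoidHom.ext fun h => by rw [MonoidHom.mul_apply, MonoidHom.mul_apply, mul_comm]

/-- `η⁻¹⁻¹ = η`, pointwise. [folklore] -/
private theorem hom_inv_inv (η : H →* ℂˣ) : η⁻¹⁻¹ = η :=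
  MonoidHom.ext fun h => by rw [MonoidHom.inv_apply, MonoidHom.inv_apply, inv_inv]

/-- **`s ⊗ 1 = s`**: twisting by the trivial character changes nothing. [cite: MoeglinVignerasWaldspurger1987, Chap. 2 II.1 (B)] -/
@[simp] theorem adelicMpCont.twist_one : adelicMpCont.twist F ι T s 1 = s :=
  MonoidHom.ext fun h => adelicMpCont.twist_eq_of_eq_one s 1 (MonoidHom.one_apply h)

/-- **`(s ⊗ η) ⊗ η' = s ⊗ (η' · η)`**: the twist is an action of the character group (the scalars are a homomorphic image of `ℂˣ`
in the centre). [cite: MoeglinVignerasWaldspurger1987, Chap. 2 II.1 (B)] -/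
theorem adelicMpCont.twist_twist :
    adelicMpCont.twist F ι T (adelicMpCont.twist F ι T s η) η' = adelicMpCont.twist F ι T s (η' * η) :=
  MonoidHom.ext fun h =>
    show adelicMpCont.ofScalar F ι T (η' h) * (adelicMpCont.ofScalar F ι T (η h) * s h) =
        adelicMpCont.ofScalar F ι T ((η' * η) h) * s h from
      (mul_assoc _ _ _).symm.trans (congrArg (· * s h) (map_mul (adelicMpCont.ofScalar F ι T) (η' h) (η h)).symm)

/-- the action in the other order: `(s ⊗ η) ⊗ η' = s ⊗ (η · η')` (the character group is commutative).
[cite: MoeglinVignerasWaldspurger1987, Chap. 2 II.1 (B)] -/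
theorem adelicMpCont.twist_twist' :
    adelicMpCont.twist F ι T (adelicMpCont.twist F ι T s η) η' = adelicMpCont.twist F ι T s (η * η') :=
  (adelicMpCont.twist_twist s η η').trans (congrArg (adelicMpCont.twist F ι T s) (hom_mul_comm η η'))

/-- `(s ⊗ η) ⊗ η⁻¹ = s`. [cite: MoeglinVignerasWaldspurger1987, Chap. 2 II.1 (B)] -/
@[simp] theorem adelicMpCont.twist_twist_inv :
    adelicMpCont.twist F ι T (adelicMpCont.twist F ι T s η) η⁻¹ = s :=
  (adelicMpCont.twist_twist s η η⁻¹).trans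
    ((congrArg (adelicMpCont.twist F ι T s) (hom_inv_mul_cancel η)).trans (adelicMpCont.twist_one s))

/-- `(s ⊗ η⁻¹) ⊗ η = s`. [cite: MoeglinVignerasWaldspurger1987, Chap. 2 II.1 (B)] -/
@[simp] theorem adelicMpCont.twist_inv_twist :
    adelicMpCont.twist F ι T (adelicMpCont.twist F ι T s η⁻¹) η = s :=
  (adelicMpCont.twist_twist s η⁻¹ η).trans
    ((congrArg (adelicMpCont.twist F ι T s) (hom_mul_inv_cancel η)).trans (adelicMpCont.twist_one s))

/-- **`s' = s ⊗ η → s = s' ⊗ η⁻¹`** — turning a splitting identity round (e.g. the output `s' = s ⊗ ĉ` of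
★ `UnitaryDualPair.exists_eq_twist_of_isCompatible` into `s = s' ⊗ ĉ⁻¹`).
[cite: MoeglinVignerasWaldspurger1987, Chap. 2 II.1 (B)] [cite: GelbartRogawski1991, §3.1 Remark p. 457 L4–13] -/
theorem adelicMpCont.eq_twist_inv_of_eq_twist {s s' : H →* adelicMpCont F ι T} {η : H →* ℂˣ}
    (h : s' = adelicMpCont.twist F ι T s η) : s = adelicMpCont.twist F ι T s' η⁻¹ :=
  (adelicMpCont.twist_twist_inv s η).symm.trans (congrArg (fun t => adelicMpCont.twist F ι T t η⁻¹) h.symm)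

/-- `s' = s ⊗ η ↔ s = s' ⊗ η⁻¹`. [cite: MoeglinVignerasWaldspurger1987, Chap. 2 II.1 (B)] -/
theorem adelicMpCont.eq_twist_iff_eq_twist_inv {s s' : H →* adelicMpCont F ι T} {η : H →* ℂˣ} :
    s' = adelicMpCont.twist F ι T s η ↔ s = adelicMpCont.twist F ι T s' η⁻¹ :=
  ⟨adelicMpCont.eq_twist_inv_of_eq_twist, fun h => (adelicMpCont.eq_twist_inv_of_eq_twist h).trans
    (congrArg (adelicMpCont.twist F ι T s) (hom_inv_inv η))⟩

end Literature.NumberTheory.Weil1964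

end
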